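import Summits.QuantumFields.BalabanUV.Beta.D1BFx.TorusJetArrays
import Summits.QuantumFields.BalabanUV.Beta.D1BFx.RJetAssembly

/-!
# `BalabanUV.Beta.D1BFx.TorusJetSandwichArrays` — road «BF-x» for binder row D1, slot (K), X₃(ii) ROUTE T, owner row **«TB4-W»** (K-ASSEMBLY-SPEC v2.5 §3
# (T3); ruling ρ-g6-13 (1), NOTE ρ-g6-13b), PART 3b-β FILE 2 — **THE ARRAY DICTIONARY FOR THE SANDWICH WORDS**: for a jointly `s`-periodic site kernel
# `Y` on `ℤ⁴` with torus matrix `Ŷ`, the three bond × bond words from which PART 3b-α's projector form builds the stripped weight jets are fibrewise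
# periodisations of leaf-05-g3's J5 assembly words (`RJetAssembly`):  **`D̂·Ŷ·D̂ᵀ = (dSw Y)^`** (`d∘Y∘dᵀ`; `Y` row-bounded),
# **`Ê_{(σu,κ)}·Ŷ·D̂ᵀ = (arr s (jetR κ u Y))^`** (`Ḋ∘Y∘dᵀ`) and **`D̂·Ŷ·Ê_{(σu,κ)}ᵀ = (arr s (jetC κ u Y))^`** (`d∘Y∘Ḋᵀ`) (`Y` decaying), hence
# **`Ê·Ŷ·D̂ᵀ − D̂·Ŷ·Êᵀ = −(arr s (dJetSw κ u Y))^`** — the formal anchor of PART 2's product rule for `M̂ₛ = Ljet·D̂ᵀ − L̂·Êᵀ` and of the J5 junction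
# `twgt₁ = (dSw Ṙ − dJetSw R)^` (PART 3b-α) in TA2's `arr` currency

HONEST DEPENDENCY (cell records, verbatim): «continuum YM on T⁴ ⇐ BetaPertH ∧ nine spine estimates (0/9 proved); BetaPertH ⇐ (D1) ∧ (D4) ∧
CAP+tail; G-an2-4 gates asym, D1 and NE2/3/4.»  HONEST FRAMING (cell contract, verbatim): «discharging `BetaPertH` makes Bałaban's UV stability
UNCONDITIONAL — a real constructive-QFT result; it is NOT the continuum limit and NOT the Clay problem.»  THIS MODULE DISCHARGES NOTHING of (K),
of D1 or of the wall: two [our object] data definitions (`jetR`, `jetC`: the two one-sided `Ḋ`-words of `RJetAssembly.dJetSw`, closed form) and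
[folklore] image-sum ∕ periodisation bookkeeping over an4's `periodise₂` dictionary (`periodise₂_eq_tsum_of_rep`, `IsPeriodic₂.shift_left`,
`periodise₂_compKer_matrix`, `summable_row_imageShift`), gan24-leaf-06-g29's TA2 `PeriodicArrays` (`arr`, `periodise₂_arr`, `periodic_of_shiftK`),
leaf-05-g3's `RJetAssembly` (`dSw`, `dJetSw`, `abs_sub_le_of_decay`), FILE 1 `TorusJetArrays` (`tsum_ind`, `tip_siteOf`), PART 2 `TorusCoframeJets`
(`Djet`, `Dhat_apply_eq`), gan24-leaf-06-g31's `TorusHodgeWeight.Dhat` (`Dhat_apply`, `Dhat_transpose_apply`), `StencilKernels`, BY NAME.  No `def … : Prop`,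
nothing cited, no wall binder instantiated, 0 sorry.  0∕4 binders of row D1; (K) NOT closed; NOT D1, NOT BetaPertH, NOT continuum, NOT Clay.

ABSOLUTE RULE (cell charter, verbatim): «No internally-minted statement may enter as a cited fact. Every hypothesis is either kernel-proved in this
package or a verbatim quotation of a PUBLISHED theorem with page reference. The manuscript(s) under audit are NOT citable for their own disputed
steps — they are the thing under adjudication; programme-internal (2001/route/tribunal) claims are never citable.»

CONTENT (`Y : MKer 4 Unit`, `Yk := Kfib (toF Y) ⋆ ⋆` its scalar kernel, `Ŷ := Matrix.of (periodise₂ s Yk)`, `σ := siteOf 4 s`, `ē_κ := σ(unitVec κ)`, `D̂ := Dhat 4 s`,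
`Ê := Djet s (σu, κ)`):
* §1 [folklore] image sums of a periodic kernel: `tsum_col_images`, `tsum_row_images` (`Σ'_t Y(p + s·t, q) = Ŷ(σp, σq)`), `summable_row_images`.
* §2 [folklore] **`Dhat_mul_Yhat_mul_Dhat_transpose`** (`D̂ŶD̂ᵀ = (toF (dSw Y))^`, `Y` periodic with a row bound; `Kfib_toF_dSw` = an4's `dz∘Y∘codiff` composition).
* §3 [our object] `jetR κ u Y` (`Ḋ∘Y∘dᵀ`: `[x = u ∧ α = κ]·(Y(u+e)(z+e_β) − Y(u+e) z)`), `jetC κ u Y` (`d∘Y∘Ḋᵀ`); `dJetSw_eq_jetC_sub_jetR` (`rfl`); `biLoc_jetR∕jetC`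
  (from `RJetAssembly.abs_sub_le_of_decay`).
* §4 [folklore] **`Djet_mul_Yhat_mul_Dhat_transpose = (arr jetR)^`**, **`Dhat_mul_Yhat_mul_Djet_transpose = (arr jetC)^`** and
  **`Djet_sandwich_sub : ÊŶD̂ᵀ − D̂ŶÊᵀ = −(arr s (dJetSw κ u Y))^`** (`Y` decaying and block-periodic).
* §5 [folklore] the SITE word of NOTE ρ-g6-13b's ghost jet `Xₛ = Nᵀ(Ljet·L̂ − L̂·(ÊᵀD̂))N`: **`transpose_Djet_mul_Dhat_eq_arr : ÊᵀD̂ = (arr (ptPair (u+e) (u+e)))^ − (arr (ptPair (u+e) u))^`**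
  (contact minus hop at the far endpoint = PART 1's `ḊᵀD₀`, `compF_trF_djF_dzF_apply`).
NOT HERE: the two-`Ê` words `ÊₛŶÊₜᵀ` (their `ℤ⁴` table is `p`-dependent: `arr (Ḋₛ ∘ (arr Y) ∘ Ḋₜᵀ)`, `PeriodicArrays.comp_arr_arr` — TB5-2's business), TB4-tables (T1), TB5.
Provenance: D1 formalisation swarm, unit `b2b-balaban-beta-d1-formalise-leaf-03` (gen 9), claim «TB4-W» journal l.23490 ∕ plan l.24110, 2026-08-21.
-/

noncomputable section

namespace Summit.QuantumFields.BalabanUV.Beta.D1BFx.TorusJetSandwichArrays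

open Matrix
open scoped BigOperators
open Literature.MathematicalPhysics.QuantumFieldTheory.Balaban1983to89
open Literature.MathematicalPhysics.QuantumFieldTheory.Balaban1983to89.Beta
open B12Sec2to5 (l1 l1_nonneg)
open ExpKernelCalculus (MKer BiLoc Decays shiftK)
open AffineAveraging (unitVec dz)
open Summit.QuantumFields.BalabanUV.Beta.D1BFx.PeriodicArrays (arr toF toF_apply Kfib_toF periodise₂_arr periodic_of_shiftK summable_arr_term)
open Summit.QuantumFields.BalabanUV.Beta.D1BFx.FibredPeriodisation (Kfib Kfib_apply periodiseF periodiseF_apply isPeriodic₂_compKer rowBound_compKer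
  periodise₂_compKer_matrix)
open Summit.QuantumFields.BalabanUV.Beta.D1BFx.StencilKernels (dzKer codiffKer dz_eq_tsum_dzKer summable_dzKer_row isPeriodic₂_codiffKer)
open Summit.QuantumFields.BalabanUV.Beta.D1BFx.VectorPropagatorImages (rowBound_codiffKer)
open Summit.QuantumFields.BalabanUV.Beta.D1BFx.TorusHodgeWeight (Dhat Dhat_apply Dhat_transpose_apply)
open Summit.QuantumFields.BalabanUV.Beta.D1BFx.RJetAssembly (dSw dSw_apply dJetSw dJetSw_apply abs_sub_le_of_decay)
open Summit.QuantumFields.BalabanUV.Beta.D1BFx.TorusCoframeJets (tip Djet Djet_apply Dhat_apply_eq transpose_Djet_mul_Dhat_apply)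
open Summit.QuantumFields.BalabanUV.Beta.D1BFx.TorusJetArrays (tsum_ind summable_ind tip_siteOf ptPair periodise_arr_ptPair)

variable (s : ℕ) [NeZero s]

/-! ## §1 Image sums of a jointly periodic kernel are entries of its torus matrix -/

section Images

variable {K : Kernel₂ 4} (hper : IsPeriodic₂ s K) (hrow : ∀ p, Summable (K p))
include hper hrow

/-- [folklore] COLUMN IMAGES: `Σ'_n K p (q + s·n) = K̂ (σp) (σq)` (an4's representative independence). -/
theorem tsum_col_images (p q : Fin 4 → ℤ) : ∑' n, K p (imageShift s q n) = periodise₂ s K (siteOf 4 s p) (siteOf 4 s q) :=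
  (periodise₂_eq_tsum_of_rep hper hrow rfl rfl).symm

/-- [folklore] ROW IMAGES: `Σ'_t K (p + s·t) q = K̂ (σp) (σq)` (periodicity moves the images to the column, then §1). -/
theorem tsum_row_images (p q : Fin 4 → ℤ) : ∑' t, K (imageShift s p t) q = periodise₂ s K (siteOf 4 s p) (siteOf 4 s q) :=
  calc ∑' t, K (imageShift s p t) q = ∑' t, K p (imageShift s q ((Equiv.neg (Fin 4 → ℤ)) t)) :=
        tsum_congr fun t => by rw [Equiv.neg_apply, hper.shift_left]
    _ = ∑' n, K p (imageShift s q n) := (Equiv.neg (Fin 4 → ℤ)).tsum_eq (fun n => K p (imageShift s q n))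
    _ = periodise₂ s K (siteOf 4 s p) (siteOf 4 s q) := tsum_col_images s hper hrow p q

omit hper in
/-- [folklore] Column image families are summable. -/
theorem summable_col_images (p q : Fin 4 → ℤ) : Summable fun n => K p (imageShift s q n) := summable_row_imageShift hrow p q

/-- [folklore] Row image families are summable. -/
theorem summable_row_images (p q : Fin 4 → ℤ) : Summable fun t => K (imageShift s p t) q :=
  ((Equiv.neg (Fin 4 → ℤ)).summable_iff.mpr (summable_row_imageShift hrow p q)).congr fun t => by
    rw [Function.comp_apply, Equiv.neg_apply, hper.shift_left]

end Images

/-! ## §2 `D̂·Ŷ·D̂ᵀ = (dSw Y)^` for a jointly periodic row-bounded site kernel -/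

section DSw

variable (Y : MKer 4 Unit)

/-- [folklore] Column action of `codiffKer`: `Σ'_r f r · codiffKer l r w = f (w + e_l) − f w` (two-point stencil). -/
theorem tsum_mul_codiffKer (f : (Fin 4 → ℤ) → ℝ) (l : Fin 4) (w : Fin 4 → ℤ) :
    ∑' r, f r * codiffKer l r w = f (w + unitVec l) - f w := by
  have e : (fun r => f r * codiffKer l r w) = fun r => (if r = w + unitVec l then f r else 0) - (if r = w then f r else 0) := by
    funext r
    have h1 : (w = r - unitVec l) ↔ (r = w + unitVec l) := by
      constructor <;> intro h
      · rw [h, sub_add_cancel]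
      · rw [h, add_sub_cancel_right]
    simp only [codiffKer, h1, @eq_comm _ w r]
    split_ifs <;> ring
  rw [e, Summable.tsum_sub, tsum_eq_single (w + unitVec l) (fun r hr => if_neg hr), if_pos rfl, tsum_eq_single w (fun r hr => if_neg hr), if_pos rfl]
  · exact summable_of_ne_finset_zero (s := {w + unitVec l}) fun r hr => by rw [Finset.mem_singleton] at hr; rw [if_neg hr]
  · exact summable_of_ne_finset_zero (s := {w}) fun r hr => by rw [Finset.mem_singleton] at hr; rw [if_neg hr]

/-- [folklore] **THE `ℤ⁴` SANDWICH AS AN4's COMPOSITION**: `Kfib (toF (dSw Y)) κ l = dzKer κ ∘ Yk ∘ codiffKer l` (finite sums; no hypothesis on `Y`). -/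
theorem Kfib_toF_dSw (κ l : Fin 4) :
    Kfib (toF (dSw Y)) κ l = compKer (dzKer κ) (compKer (Kfib (toF Y) () ()) (codiffKer l)) := by
  funext x w
  have inner : compKer (Kfib (toF Y) () ()) (codiffKer l) = fun q w => Y q (w + unitVec l) () () - Y q w () () := by
    funext q w'
    exact tsum_mul_codiffKer (fun r => Y q r () ()) l w'
  rw [Kfib_apply, toF_apply, dSw_apply, inner]
  simp only [compKer]
  rw [← dz_eq_tsum_dzKer (fun q => Y q (w + unitVec l) () () - Y q w () ()) κ x]
  simp only [dz]
  ring

/-- [folklore] **`D̂·Ŷ·D̂ᵀ = (dSw Y)^`** on every fine torus, for a jointly `s`-periodic site kernel with a row bound (two product rules of an4; the pattern of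
gan24-leaf-06-g31's `periodiseF_gaugeF` with `Pker` replaced by `Y`). -/
theorem Dhat_mul_Yhat_mul_Dhat_transpose {B : ℝ} (hper : IsPeriodic₂ s (Kfib (toF Y) () ())) (hB : RowBound (Kfib (toF Y) () ()) B) :
    Dhat 4 s * Matrix.of (periodise₂ s (Kfib (toF Y) () ())) * (Dhat 4 s)ᵀ = Matrix.of (periodiseF s (toF (dSw Y))) := by
  ext ⟨x, κ⟩ ⟨y, l⟩
  have hin : Matrix.of (periodise₂ s (compKer (Kfib (toF Y) () ()) (codiffKer l)))
      = Matrix.of (periodise₂ s (Kfib (toF Y) () ())) * Matrix.of (periodise₂ s (codiffKer (d := 4) l)) :=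
    periodise₂_compKer_matrix (fun p => hB.summable_abs p) (isPeriodic₂_codiffKer l _) (rowBound_codiffKer l)
  have hout : Matrix.of (periodise₂ s (compKer (dzKer κ) (compKer (Kfib (toF Y) () ()) (codiffKer l))))
      = Matrix.of (periodise₂ s (dzKer (d := 4) κ)) * Matrix.of (periodise₂ s (compKer (Kfib (toF Y) () ()) (codiffKer l))) :=
    periodise₂_compKer_matrix (fun p => (summable_dzKer_row κ p).abs) (isPeriodic₂_compKer hper (isPeriodic₂_codiffKer l _))
      (rowBound_compKer hB (rowBound_codiffKer l))
  have hxy := congr_fun (congr_fun hout x) y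
  rw [Matrix.of_apply, hin, ← Matrix.mul_assoc] at hxy
  rw [Matrix.of_apply, periodiseF_apply, Kfib_toF_dSw, hxy]
  simp only [Matrix.mul_apply, Matrix.of_apply, Dhat_apply, Dhat_transpose_apply]

end DSw

/-! ## §3 The two one-sided `Ḋ`-words of `dJetSw` and their localisation -/

/-- [our object] **`jetR κ u Y := Ḋ∘Y∘dᵀ`** (row pinned at the bond `(κ,u)`), closed form `[x = u ∧ α = κ]·(Y(u+e)(z+e_β) − Y(u+e) z)`.  A definition. -/
def jetR (κ : Fin 4) (u : Fin 4 → ℤ) (Y : MKer 4 Unit) : MKer 4 (Fin 4) := fun x z α β =>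
  if x = u ∧ α = κ then Y (u + unitVec κ) (z + unitVec β) () () - Y (u + unitVec κ) z () () else 0

/-- [our object] **`jetC κ u Y := d∘Y∘Ḋᵀ`** (column pinned at the bond `(κ,u)`), closed form `[z = u ∧ β = κ]·(Y(x+e_α)(u+e) − Y x (u+e))`.  A definition. -/
def jetC (κ : Fin 4) (u : Fin 4 → ℤ) (Y : MKer 4 Unit) : MKer 4 (Fin 4) := fun x z α β =>
  if z = u ∧ β = κ then Y (x + unitVec α) (u + unitVec κ) () () - Y x (u + unitVec κ) () () else 0

variable (κ : Fin 4) (u : Fin 4 → ℤ) (Y : MKer 4 Unit)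

/-- [our object] Unfolding `jetR`. -/
@[simp] theorem jetR_apply (x z : Fin 4 → ℤ) (α β : Fin 4) : jetR κ u Y x z α β
    = if x = u ∧ α = κ then Y (u + unitVec κ) (z + unitVec β) () () - Y (u + unitVec κ) z () () else 0 := rfl

/-- [our object] Unfolding `jetC`. -/
@[simp] theorem jetC_apply (x z : Fin 4 → ℤ) (α β : Fin 4) : jetC κ u Y x z α β
    = if z = u ∧ β = κ then Y (x + unitVec α) (u + unitVec κ) () () - Y x (u + unitVec κ) () () else 0 := rfl

/-- [folklore] **`dJetSw = jetC − jetR`** (leaf-05-g3's `(d∘Y∘Ḋᵀ) − (Ḋ∘Y∘dᵀ)`, by `rfl`). -/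
theorem dJetSw_eq_jetC_sub_jetR : dJetSw κ u Y = jetC κ u Y - jetR κ u Y := by
  funext x z α β
  rfl

omit [NeZero s] in
/-- [folklore] LOCALISATION of `jetR`: `Decays Y C δ`, `δ ≥ 0` ⟹ `BiLoc (jetR κ u Y) u u (2·C·e^{2δ}) δ`. -/
theorem biLoc_jetR {C δ : ℝ} (hδ : 0 ≤ δ) (hY : Decays Y C δ) : BiLoc (jetR κ u Y) u u (2 * C * Real.exp (2 * δ)) δ := by
  intro x z α β
  have hC : 0 ≤ C := le_trans (abs_nonneg _) ((hY u u () ()).trans (by rw [sub_self]; simp [l1]))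
  rw [jetR_apply, mul_add (-δ), Real.exp_add]
  by_cases hx : x = u ∧ α = κ
  · rw [if_pos hx, hx.1, sub_self, show l1 (0 : Fin 4 → ℤ) = 0 by simp [l1], mul_zero, Real.exp_zero, one_mul]
    exact abs_sub_le_of_decay κ u hδ hC (fun q => by rw [ExpKernelCalculus.l1_sub_symm]; exact hY (u + unitVec κ) q () ()) z β
  · rw [if_neg hx, abs_zero]; positivity

omit [NeZero s] in
/-- [folklore] LOCALISATION of `jetC`: `Decays Y C δ`, `δ ≥ 0` ⟹ `BiLoc (jetC κ u Y) u u (2·C·e^{2δ}) δ`. -/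
theorem biLoc_jetC {C δ : ℝ} (hδ : 0 ≤ δ) (hY : Decays Y C δ) : BiLoc (jetC κ u Y) u u (2 * C * Real.exp (2 * δ)) δ := by
  intro x z α β
  have hC : 0 ≤ C := le_trans (abs_nonneg _) ((hY u u () ()).trans (by rw [sub_self]; simp [l1]))
  rw [jetC_apply, mul_add (-δ), Real.exp_add]
  by_cases hz : z = u ∧ β = κ
  · rw [if_pos hz, hz.1, sub_self, show l1 (0 : Fin 4 → ℤ) = 0 by simp [l1], mul_zero, Real.exp_zero, mul_one]
    exact abs_sub_le_of_decay κ u hδ hC (fun p => hY p (u + unitVec κ) () ()) x α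
  · rw [if_neg hz, abs_zero]; positivity

/-! ## §4 The `Ê`-words as periodised arrays -/

section Words

variable {Y} {C δ : ℝ}

omit [NeZero s] in
/-- [folklore] The scalar kernel of a block-periodic `MKer` is jointly periodic. -/
theorem isPeriodic₂_Kfib (hper : ∀ t : Fin 4 → ℤ, shiftK ((s : ℤ) • t) Y = Y) : IsPeriodic₂ s (Kfib (toF Y) () ()) := fun x y t => by
  show Y (imageShift s x t) (imageShift s y t) () () = Y x y () ()
  exact periodic_of_shiftK hper x y t () ()

omit [NeZero s] in
/-- [folklore] The scalar kernel of a decaying `MKer` has summable rows. -/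
theorem summable_Kfib_row (hY : Decays Y C δ) (hδ : 0 < δ) (p : Fin 4 → ℤ) : Summable (Kfib (toF Y) () () p) :=
  Decay₂.summable_row (K := Kfib (toF Y) () ()) (fun x y => hY x y () ()) hδ p

variable (hY : Decays Y C δ) (hδ : 0 < δ) (hper : ∀ t : Fin 4 → ℤ, shiftK ((s : ℤ) • t) Y = Y)
include hY hδ hper

/-- [folklore] **`Ê_{(σu,κ)}·Ŷ·D̂ᵀ = (arr s (jetR κ u Y))^`**: the row-pinned word of the torus (single-entry `Ê`, periodised `Ŷ`, gradient `D̂`) is the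
fibrewise periodisation of TA2's array of `Ḋ∘Y∘dᵀ`. -/
theorem Djet_mul_Yhat_mul_Dhat_transpose :
    Djet s (siteOf 4 s u, κ) * Matrix.of (periodise₂ s (Kfib (toF Y) () ())) * (Dhat 4 s)ᵀ
      = Matrix.of (periodiseF s (toF (arr s (jetR κ u Y)))) := by
  have hperK := isPeriodic₂_Kfib s hper
  have hrowK := summable_Kfib_row hY hδ
  ext ⟨x, α⟩ ⟨z, β⟩
  -- the torus side
  have lhs : (Djet s (siteOf 4 s u, κ) * Matrix.of (periodise₂ s (Kfib (toF Y) () ())) * (Dhat 4 s)ᵀ) (x, α) (z, β)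
      = if x = siteOf 4 s u ∧ α = κ then
          periodise₂ s (Kfib (toF Y) () ()) (siteOf 4 s (u + unitVec κ)) (z + siteOf 4 s (unitVec β))
            - periodise₂ s (Kfib (toF Y) () ()) (siteOf 4 s (u + unitVec κ)) z else 0 := by
    rw [Matrix.mul_assoc, Matrix.mul_apply, Finset.sum_eq_single (tip s (siteOf 4 s u, κ))]
    · rw [Djet_apply, tip_siteOf]
      have hcol : (Matrix.of (periodise₂ s (Kfib (toF Y) () ())) * (Dhat 4 s)ᵀ) (siteOf 4 s (u + unitVec κ)) (z, β)
          = periodise₂ s (Kfib (toF Y) () ()) (siteOf 4 s (u + unitVec κ)) (z + siteOf 4 s (unitVec β))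
            - periodise₂ s (Kfib (toF Y) () ()) (siteOf 4 s (u + unitVec κ)) z := by
        rw [Matrix.mul_apply]
        simp only [Matrix.of_apply, Matrix.transpose_apply, Dhat_apply_eq, mul_sub, mul_ite, mul_one, mul_zero, Finset.sum_sub_distrib,
          Finset.sum_ite_eq', Finset.mem_univ, if_true]
      rw [hcol]
      by_cases h : x = siteOf 4 s u ∧ α = κ
      · rw [if_pos h, if_pos ⟨Prod.ext h.1 h.2, rfl⟩, one_mul]
      · rw [if_neg h, if_neg (fun hh => h ⟨(Prod.ext_iff.mp hh.1).1, (Prod.ext_iff.mp hh.1).2⟩), zero_mul]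
    · intro w _ hw
      rw [Djet_apply, if_neg (fun hh => hw hh.2), zero_mul]
    · intro h; exact absurd (Finset.mem_univ _) h
  -- the array side
  have rhs : periodiseF s (toF (arr s (jetR κ u Y))) (x, α) (z, β)
      = if x = siteOf 4 s u ∧ α = κ then
          periodise₂ s (Kfib (toF Y) () ()) (siteOf 4 s (u + unitVec κ)) (z + siteOf 4 s (unitVec β))
            - periodise₂ s (Kfib (toF Y) () ()) (siteOf 4 s (u + unitVec κ)) z else 0 := by
    rw [periodiseF_apply, periodise₂_arr (biLoc_jetR κ u Y hδ.le hY) hδ]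
    simp only [jetR_apply]
    have inner : ∀ t : Fin 4 → ℤ, ∑' n : Fin 4 → ℤ,
        (if imageShift s (windowMap 4 s x) t = u ∧ α = κ then
          Y (u + unitVec κ) (imageShift s (windowMap 4 s z) n + unitVec β) () () - Y (u + unitVec κ) (imageShift s (windowMap 4 s z) n) () ()
          else 0)
        = if imageShift s (windowMap 4 s x) t = u then
            (if α = κ then periodise₂ s (Kfib (toF Y) () ()) (siteOf 4 s (u + unitVec κ)) (z + siteOf 4 s (unitVec β))
              - periodise₂ s (Kfib (toF Y) () ()) (siteOf 4 s (u + unitVec κ)) z else 0) else 0 := by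
      intro t
      by_cases ht : imageShift s (windowMap 4 s x) t = u
      · by_cases hα : α = κ
        · simp only [ht, hα, and_self, if_true]
          have e1 : ∀ n : Fin 4 → ℤ, imageShift s (windowMap 4 s z) n + unitVec β = imageShift s (windowMap 4 s z + unitVec β) n := fun n => by
            rw [add_comm, add_imageShift, add_comm]
          simp only [e1]
          have hsY : ∀ p q : Fin 4 → ℤ, Summable fun n => Y p (imageShift s q n) () () := fun p q => summable_col_images s hrowK p q
          rw [Summable.tsum_sub (hsY _ _) (hsY _ _)]
          have c1 : ∑' n, Y (u + unitVec κ) (imageShift s (windowMap 4 s z + unitVec β) n) () ()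
              = periodise₂ s (Kfib (toF Y) () ()) (siteOf 4 s (u + unitVec κ)) (siteOf 4 s (windowMap 4 s z + unitVec β)) :=
            tsum_col_images s hperK hrowK (u + unitVec κ) (windowMap 4 s z + unitVec β)
          have c2 : ∑' n, Y (u + unitVec κ) (imageShift s (windowMap 4 s z) n) () ()
              = periodise₂ s (Kfib (toF Y) () ()) (siteOf 4 s (u + unitVec κ)) (siteOf 4 s (windowMap 4 s z)) :=
            tsum_col_images s hperK hrowK (u + unitVec κ) (windowMap 4 s z)
          rw [c1, c2, siteOf_add s (windowMap 4 s z) (unitVec β), siteOf_windowMap]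
        · simp only [ht, hα, and_false, if_false, tsum_zero]
          rfl
      · simp only [ht, false_and, if_false, tsum_zero]
    rw [tsum_congr inner, tsum_ind]
    by_cases hx : x = siteOf 4 s u <;> by_cases hα : α = κ <;> simp [hx, hα]
  rw [lhs, Matrix.of_apply, rhs]

/-- [folklore] **`D̂·Ŷ·Ê_{(σu,κ)}ᵀ = (arr s (jetC κ u Y))^`**: the column-pinned word is the fibrewise periodisation of TA2's array of `d∘Y∘Ḋᵀ`. -/
theorem Dhat_mul_Yhat_mul_Djet_transpose :
    Dhat 4 s * Matrix.of (periodise₂ s (Kfib (toF Y) () ())) * (Djet s (siteOf 4 s u, κ))ᵀ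
      = Matrix.of (periodiseF s (toF (arr s (jetC κ u Y)))) := by
  have hperK := isPeriodic₂_Kfib s hper
  have hrowK := summable_Kfib_row hY hδ
  ext ⟨x, α⟩ ⟨z, β⟩
  have lhs : (Dhat 4 s * Matrix.of (periodise₂ s (Kfib (toF Y) () ())) * (Djet s (siteOf 4 s u, κ))ᵀ) (x, α) (z, β)
      = if z = siteOf 4 s u ∧ β = κ then
          periodise₂ s (Kfib (toF Y) () ()) (x + siteOf 4 s (unitVec α)) (siteOf 4 s (u + unitVec κ))
            - periodise₂ s (Kfib (toF Y) () ()) x (siteOf 4 s (u + unitVec κ)) else 0 := by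
    rw [Matrix.mul_apply, Finset.sum_eq_single (tip s (siteOf 4 s u, κ))]
    · rw [Matrix.transpose_apply, Djet_apply, tip_siteOf]
      have hrow : (Dhat 4 s * Matrix.of (periodise₂ s (Kfib (toF Y) () ()))) (x, α) (siteOf 4 s (u + unitVec κ))
          = periodise₂ s (Kfib (toF Y) () ()) (x + siteOf 4 s (unitVec α)) (siteOf 4 s (u + unitVec κ))
            - periodise₂ s (Kfib (toF Y) () ()) x (siteOf 4 s (u + unitVec κ)) := by
        rw [Matrix.mul_apply]
        simp only [Matrix.of_apply, Dhat_apply_eq, sub_mul, ite_mul, one_mul, zero_mul, Finset.sum_sub_distrib, Finset.sum_ite_eq',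
          Finset.mem_univ, if_true]
      rw [hrow]
      by_cases h : z = siteOf 4 s u ∧ β = κ
      · rw [if_pos h, if_pos ⟨Prod.ext h.1 h.2, rfl⟩, mul_one]
      · rw [if_neg h, if_neg (fun hh => h ⟨(Prod.ext_iff.mp hh.1).1, (Prod.ext_iff.mp hh.1).2⟩), mul_zero]
    · intro w _ hw
      rw [Matrix.transpose_apply, Djet_apply, if_neg (fun hh => hw hh.2), mul_zero]
    · intro h; exact absurd (Finset.mem_univ _) h
  have rhs : periodiseF s (toF (arr s (jetC κ u Y))) (x, α) (z, β)
      = if z = siteOf 4 s u ∧ β = κ then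
          periodise₂ s (Kfib (toF Y) () ()) (x + siteOf 4 s (unitVec α)) (siteOf 4 s (u + unitVec κ))
            - periodise₂ s (Kfib (toF Y) () ()) x (siteOf 4 s (u + unitVec κ)) else 0 := by
    rw [periodiseF_apply, periodise₂_arr (biLoc_jetC κ u Y hδ.le hY) hδ]
    simp only [jetC_apply]
    have inner : ∀ t : Fin 4 → ℤ, ∑' n : Fin 4 → ℤ,
        (if imageShift s (windowMap 4 s z) n = u ∧ β = κ then
          Y (imageShift s (windowMap 4 s x) t + unitVec α) (u + unitVec κ) () () - Y (imageShift s (windowMap 4 s x) t) (u + unitVec κ) () ()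
          else 0)
        = (Y (imageShift s (windowMap 4 s x + unitVec α) t) (u + unitVec κ) () () - Y (imageShift s (windowMap 4 s x) t) (u + unitVec κ) () ())
            * (if z = siteOf 4 s u ∧ β = κ then 1 else 0) := by
      intro t
      have e1 : imageShift s (windowMap 4 s x) t + unitVec α = imageShift s (windowMap 4 s x + unitVec α) t := by
        rw [add_comm, add_imageShift, add_comm]
      rw [e1]
      by_cases hβ : β = κ
      · simp only [hβ, and_true]
        rw [show (fun n : Fin 4 → ℤ => if imageShift s (windowMap 4 s z) n = u then
              Y (imageShift s (windowMap 4 s x + unitVec α) t) (u + unitVec κ) () () - Y (imageShift s (windowMap 4 s x) t) (u + unitVec κ) () ()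
              else 0)
            = fun n => (Y (imageShift s (windowMap 4 s x + unitVec α) t) (u + unitVec κ) () () - Y (imageShift s (windowMap 4 s x) t) (u + unitVec κ) () ())
              * (if imageShift s (windowMap 4 s z) n = u then (1 : ℝ) else 0) by funext n; split_ifs <;> simp,
          tsum_mul_left, tsum_ind]
      · simp only [hβ, and_false, if_false, tsum_zero, mul_zero]
    have hsYr : ∀ p q : Fin 4 → ℤ, Summable fun t => Y (imageShift s p t) q () () := fun p q => summable_row_images s hperK hrowK p q
    rw [tsum_congr inner, tsum_mul_right, Summable.tsum_sub (hsYr _ _) (hsYr _ _)]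
    have r1 : ∑' t, Y (imageShift s (windowMap 4 s x + unitVec α) t) (u + unitVec κ) () ()
        = periodise₂ s (Kfib (toF Y) () ()) (siteOf 4 s (windowMap 4 s x + unitVec α)) (siteOf 4 s (u + unitVec κ)) :=
      tsum_row_images s hperK hrowK (windowMap 4 s x + unitVec α) (u + unitVec κ)
    have r2 : ∑' t, Y (imageShift s (windowMap 4 s x) t) (u + unitVec κ) () ()
        = periodise₂ s (Kfib (toF Y) () ()) (siteOf 4 s (windowMap 4 s x)) (siteOf 4 s (u + unitVec κ)) :=
      tsum_row_images s hperK hrowK (windowMap 4 s x) (u + unitVec κ)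
    rw [r1, r2, siteOf_add s (windowMap 4 s x) (unitVec α), siteOf_windowMap]
    split_ifs <;> simp
  rw [lhs, Matrix.of_apply, rhs]

/-- [folklore] **THE `Ḋ`-WORDS OF PART 2 ARE MINUS J5's `dJetSw`, ARRAYED**: `Ê·Ŷ·D̂ᵀ − D̂·Ŷ·Êᵀ = −(arr s (dJetSw κ u Y))^` on every fine torus
(THE CONVENTION `ε = +1` of PART 1 against leaf-05-g3's bond-level rule; the sign dictionary of PART 1b made formal in TA2's currency). -/
theorem Djet_sandwich_sub :
    Djet s (siteOf 4 s u, κ) * Matrix.of (periodise₂ s (Kfib (toF Y) () ())) * (Dhat 4 s)ᵀ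
        - Dhat 4 s * Matrix.of (periodise₂ s (Kfib (toF Y) () ())) * (Djet s (siteOf 4 s u, κ))ᵀ
      = -Matrix.of (periodiseF s (toF (arr s (dJetSw κ u Y)))) := by
  rw [Djet_mul_Yhat_mul_Dhat_transpose s κ u hY hδ hper, Dhat_mul_Yhat_mul_Djet_transpose s κ u hY hδ hper]
  ext i j
  rw [Matrix.sub_apply, Matrix.neg_apply, Matrix.of_apply, Matrix.of_apply, Matrix.of_apply, periodiseF_apply, periodiseF_apply, periodiseF_apply]
  have hR := summable_arr_term (biLoc_jetR κ u Y hδ.le hY) hδ s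
  have hC := summable_arr_term (biLoc_jetC κ u Y hδ.le hY) hδ s
  have e : Kfib (toF (arr s (dJetSw κ u Y))) i.2 j.2 = fun p q => Kfib (toF (arr s (jetC κ u Y))) i.2 j.2 p q - Kfib (toF (arr s (jetR κ u Y))) i.2 j.2 p q := by
    funext p q
    simp only [Kfib_toF, PeriodicArrays.arr_apply, dJetSw_eq_jetC_sub_jetR, Pi.sub_apply]
    exact (hC p q i.2 j.2).tsum_sub (hR p q i.2 j.2)
  rw [e]
  have hrowC : ∀ p, Summable (Kfib (toF (arr s (jetC κ u Y))) i.2 j.2 p) := fun p =>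
    (PeriodicArrays.summable_abs_row_arr (biLoc_jetC κ u Y hδ.le hY) hδ s i.2 j.2 p).of_abs
  have hrowR : ∀ p, Summable (Kfib (toF (arr s (jetR κ u Y))) i.2 j.2 p) := fun p =>
    (PeriodicArrays.summable_abs_row_arr (biLoc_jetR κ u Y hδ.le hY) hδ s i.2 j.2 p).of_abs
  rw [show (fun p q => Kfib (toF (arr s (jetC κ u Y))) i.2 j.2 p q - Kfib (toF (arr s (jetR κ u Y))) i.2 j.2 p q)
      = Kfib (toF (arr s (jetC κ u Y))) i.2 j.2 + fun p q => (-1 : ℝ) * Kfib (toF (arr s (jetR κ u Y))) i.2 j.2 p q by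
        funext p q; simp only [Pi.add_apply]; ring,
    periodise₂_add hrowC (fun p => ((hrowR p).mul_left (-1)).congr fun q => rfl), periodise₂_const_mul]
  ring

end Words

/-! ## §5 The site word `ÊᵀD̂` of the ghost jet (NOTE ρ-g6-13b) as arrays of point pairs -/

/-- [folklore] **`Ê_{(σu,κ)}ᵀ·D̂ = (arr s (ptPair (u+e) (u+e)))^ − (arr s (ptPair (u+e) u))^`** ENTRYWISE: the site × site word inside the (R2) ghost jet
`Xₛ = Nᵀ(Ljet·L̂ − L̂·(ÊᵀD̂))N` is «contact minus hop at the far endpoint of the bond», the periodised array of PART 1's `ḊᵀD₀`. -/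
theorem transpose_Djet_mul_Dhat_eq_arr (x z : Site 4 s) (a b : Unit) : ((Djet s (siteOf 4 s u, κ))ᵀ * Dhat 4 s) x z
    = periodiseF s (toF (arr s (ptPair (u + unitVec κ) (u + unitVec κ)))) (x, a) (z, b)
      - periodiseF s (toF (arr s (ptPair (u + unitVec κ) u))) (x, a) (z, b) := by
  rw [transpose_Djet_mul_Dhat_apply, tip_siteOf, periodise_arr_ptPair, periodise_arr_ptPair]
  simp only [mul_sub, ite_zero_mul_ite_zero, mul_one]

end Summit.QuantumFields.BalabanUV.Beta.D1BFx.TorusJetSandwichArrays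

end
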